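import Mathlib
import HarnessLib
import Summits.Parity.GeneralizedHardyLittlewood.Theses.LiouvilleMAD
import Summits.Parity.GeneralizedHardyLittlewood.Theorems.FanDecorrelation.Negative.FanDecorrelationJointFloor
import Summits.Parity.GeneralizedHardyLittlewood.Theorems.DilatedChowla.Negative.DilatedChowlaMirror

/-!
# Strategist mirror for `FanDecorrelation` (stmt-Parity-13318):
# the FAN crux ALONE contains an effective Landau–Siegel theorem

Crux-strategist work file (unit `cstrat-stmt-Parity-13318-p1`, 2026-08-17), census heading NEGATION.
Kernel-checked here (no `sorry` intended), for the disprover / an idle prover to land verbatim at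
`Theorems/FanDecorrelation/Negative/FanDecorrelationSiegelMirrorAlone.lean` `--supports stmt-Parity-13318`.

THEOREM (`fanSiegelMirror`).
`FanDecorrelation → ∃ C₀ > 0, ¬ SiegelZerosAbove (C₀ · log)`; equivalently (`fanSiegelMirror_realZeroFree`)
`L(σ, χ) ≠ 0` for all large `q`, all primitive quadratic `χ mod q`, all `σ ∈ [1 − 1/(C₀ log² q), 1)`.
Unconditionally only Siegel's ineffective `1 − β ≥ C(ε) q^{−ε}` is known.

This upgrades the landed certificate `realZeroFree_of_MAD` (p119683), which needs BOTH MAD cruxes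
(`CosetDecorrelation ∧ FanDecorrelation → DilatedChowla →` Siegel mirror), to the fan crux BY ITSELF, and it
refutes two recorded beliefs of the chain: (i) Disproof.lean (c) "floors / tightness for fans are NOT provable by
positivity: the fan kernel is a Dirichlet kernel" — the Fejér-weighted SUM over `k` of fans IS a positive
quantity (a block variance along progressions mod `j`), and the `k = 0` mass it drags in is affordable when
the blocks are SHORT (`K = 4V` terms); (ii) Lines/SketchIdeator1-dead.md item 2 "positive-kernel (variance)
input loses the factor `Q`" — it does not, once the window is synthesised from SHORT blocks.

MECHANISM (`not_coherentBias_of_fanDecorrelation`).  Let `CoherentBias c` hold (tree def: for every `κ > 0`,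
`C'` a family of `V` progressions `c mod qν`, `1 ≤ ν ≤ V`, `qV ≤ 2M`, whose one-point sums
`P c (qν) M = Σ_{m∼M} λ(mqν+c)` share a sign and are `≥ bM`, with `b²V ≥ 4`, `V·C' ≤ M^κ`).  Put
`w(m) = Σ_ν λ(m·qν + c)` (`m ∈ (M,2M]`), `K = 4V`, and for each modulus `j ∈ [Q,2Q)`, `Q = ⌊√M⌋+1`, the SHORT
BLOCK SUMS along the progressions mod `j`: `B_j(m₀) = Σ_{s<K} w(m₀ + sj)`, `m₀ ∈ T_j = [M+1−(K−1)j, 2M]`.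
* `Σ_{m₀∈T_j} B_j(m₀) = K·Σ_m w(m) = K·Σ_ν P c (qν) M`, of absolute value `≥ K·V·b·M`      (`sum_B`);
* `#T_j = M + (K−1)j ≤ M + 2QK ≤ 2M`                                                        (`card_T_le`);
* Cauchy–Schwarz: `Q·(KVbM)² ≤ Σ_j #T_j · Σ_{T_j} B_j² ≤ 2M · Σ_j Σ_{T_j} B_j²`;
* EXPANSION: `Σ_j Σ_{T_j} B_j² = Σ_{s,s'<K} Σ_{ν,ν'≤V} fan c (qν) (qν') M (s − s')`               (`sum_j_sum_B_sq`)
  — the fans of the crux (tree `fan`, `fanDecorrelation_iff`), INCLUDING the lag `k = s − s' = 0` and the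
  autocorrelation pairs `ν = ν'`, each of which is bounded trivially by `Q·M` (`abs_fan_le`), while the
  `s ≠ s'`, `ν ≠ ν'` fans are `≤ C·M^{3/4+ϑ}` by the crux: total `≤ KV²QM + K²VQM + K²V²C M^{3/4+ϑ}`.
With `K = 4V` and `b²V ≥ 4`: `64·QV³M² ≤ 40·QV³M² + 32·V⁴C·M^{7/4+ϑ}`, i.e. `3QM² ≤ 4VC·M^{7/4+ϑ} ≤ M^{7/4+ϑ+κ}`
(`4VC ≤ V·C' ≤ M^κ` with `C' = 4C+4`), impossible for `κ ≤ (1/4 − ϑ)/2` since `Q ≥ 1`, `M ≥ 1`.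
The Siegel input is the node's LANDED chain `coherentBias_one_of_siegelZerosAbove` (black box).
-/

noncomputable section

namespace Summit.Parity.GeneralizedHardyLittlewood.Cruxes.FanDecorrelation.StrategistMirror

open Finset
open Summit.Parity.GeneralizedHardyLittlewood.Theses.LiouvilleMAD (FanDecorrelation)
open Summit.Parity.GeneralizedHardyLittlewood.Theorems.DilatedTableChowla.Negative (L abs_L_le_one)
open Summit.Parity.GeneralizedHardyLittlewood.Theorems.DilatedChowla.Negative
  (P CoherentBias SiegelZerosAbove coherentBias_one_of_siegelZerosAbove
    realZeroFree_of_not_siegelZerosAbove)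
open Summit.Parity.GeneralizedHardyLittlewood.Theorems.FanDecorrelation.Negative (fan fanDecorrelation_iff)

/-! ## §1 Lag correlations and the trivial bounds -/

/-- The lag correlation `X c n n' M d = Σ_{(m,m')∈(M,2M]², m−m'=d} λ(mn+c)λ(m'n'+c)` (the inner sum of `fan`). -/
def X (c : ℤ) (n n' M : ℕ) (d : ℤ) : ℝ :=
  ∑ p ∈ (Ioc M (2 * M) ×ˢ Ioc M (2 * M)).filter (fun p : ℕ × ℕ => (p.1 : ℤ) - p.2 = d),
    L ((p.1 : ℤ) * n + c) * L ((p.2 : ℤ) * n' + c)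

theorem fan_eq_sum_X (c : ℤ) (n n' M : ℕ) (k : ℤ) :
    fan c n n' M k = ∑ j ∈ Ico (Nat.sqrt M + 1) (2 * (Nat.sqrt M + 1)), X c n n' M (k * j) := rfl

theorem X_eq_ite (c : ℤ) (n n' M : ℕ) (d : ℤ) :
    X c n n' M d = ∑ m ∈ Ioc M (2 * M), ∑ m' ∈ Ioc M (2 * M),
      if (m : ℤ) - m' = d then L ((m : ℤ) * n + c) * L ((m' : ℤ) * n' + c) else 0 := by
  unfold X
  rw [sum_filter, sum_product]

/-- Each lag correlation has at most `M` nonzero terms, each of absolute value `≤ 1`. -/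
theorem abs_X_le (c : ℤ) (n n' M : ℕ) (d : ℤ) : |X c n n' M d| ≤ M := by
  unfold X
  set F := (Ioc M (2 * M) ×ˢ Ioc M (2 * M)).filter (fun p : ℕ × ℕ => (p.1 : ℤ) - p.2 = d) with hF
  have hcard : F.card ≤ (Ioc M (2 * M)).card := by
    refine Finset.card_le_card_of_injOn (fun p : ℕ × ℕ => p.1) ?_ ?_
    · intro p hp
      have hp' := (mem_filter.mp hp).1
      exact (mem_product.mp hp').1
    · intro p hp p' hp' heq
      have h1 : (p.1 : ℤ) - p.2 = d := (mem_filter.mp hp).2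
      have h2 : (p'.1 : ℤ) - p'.2 = d := (mem_filter.mp hp').2
      simp only at heq
      have h3 : (p.2 : ℤ) = p'.2 := by
        have : (p.1 : ℤ) = p'.1 := by exact_mod_cast heq
        linarith
      exact Prod.ext heq (by exact_mod_cast h3)
  calc |∑ p ∈ F, L ((p.1 : ℤ) * n + c) * L ((p.2 : ℤ) * n' + c)|
      ≤ ∑ p ∈ F, |L ((p.1 : ℤ) * n + c) * L ((p.2 : ℤ) * n' + c)| := abs_sum_le_sum_abs _ _
    _ ≤ ∑ _p ∈ F, (1 : ℝ) := by
        refine sum_le_sum fun p _ => ?_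
        rw [abs_mul]
        have h1 := abs_L_le_one ((p.1 : ℤ) * n + c)
        have h2 := abs_L_le_one ((p.2 : ℤ) * n' + c)
        have h0 : 0 ≤ |L ((p.1 : ℤ) * n + c)| := abs_nonneg _
        nlinarith
    _ = F.card := by simp
    _ ≤ (Ioc M (2 * M)).card := by exact_mod_cast hcard
    _ = M := by simp; omega

/-- Trivial bound for every fan: `|fan c n n' M k| ≤ Q·M`, `Q = ⌊√M⌋+1`. -/
theorem abs_fan_le (c : ℤ) (n n' M : ℕ) (k : ℤ) :
    |fan c n n' M k| ≤ ((Nat.sqrt M : ℝ) + 1) * M := by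
  rw [fan_eq_sum_X]
  calc |∑ j ∈ Ico (Nat.sqrt M + 1) (2 * (Nat.sqrt M + 1)), X c n n' M (k * j)|
      ≤ ∑ j ∈ Ico (Nat.sqrt M + 1) (2 * (Nat.sqrt M + 1)), |X c n n' M (k * j)| :=
        abs_sum_le_sum_abs _ _
    _ ≤ ∑ _j ∈ Ico (Nat.sqrt M + 1) (2 * (Nat.sqrt M + 1)), (M : ℝ) :=
        sum_le_sum fun j _ => abs_X_le c n n' M _
    _ = ((Nat.sqrt M : ℝ) + 1) * M := by
        rw [sum_const, nsmul_eq_mul]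
        have hc : (Ico (Nat.sqrt M + 1) (2 * (Nat.sqrt M + 1))).card = Nat.sqrt M + 1 := by
          rw [Nat.card_Ico]; omega
        rw [hc]
        push_cast
        ring

/-! ## §2 The family sum and the short block sums -/

/-- The family one-point function `w(m) = Σ_{ν=1}^{V} λ(m·qν + c)`. -/
def w (c : ℤ) (q V m : ℕ) : ℝ := ∑ ν ∈ Icc 1 V, L ((m : ℤ) * ((q * ν : ℕ) : ℤ) + c)

theorem abs_w_le (c : ℤ) (q V m : ℕ) : |w c q V m| ≤ V := by
  unfold w
  calc |∑ ν ∈ Icc 1 V, L ((m : ℤ) * ((q * ν : ℕ) : ℤ) + c)|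
      ≤ ∑ ν ∈ Icc 1 V, |L ((m : ℤ) * ((q * ν : ℕ) : ℤ) + c)| := abs_sum_le_sum_abs _ _
    _ ≤ ∑ _ν ∈ Icc 1 V, (1 : ℝ) := sum_le_sum fun ν _ => abs_L_le_one _
    _ = V := by simp

/-- `Σ_m w(m) = Σ_ν P c (qν) M`. -/
theorem sum_w_eq (c : ℤ) (q V M : ℕ) :
    ∑ m ∈ Ioc M (2 * M), w c q V m = ∑ ν ∈ Icc 1 V, P c (q * ν) M := by
  unfold w P
  exact sum_comm

/-- The block-start range `T = [M+1−(K−1)j, 2M] ⊂ ℤ`. -/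
def T (M K j : ℕ) : Finset ℤ := Icc ((M : ℤ) + 1 - ((K : ℤ) - 1) * j) (2 * M)

/-- The short block sum `B_j(m₀) = Σ_{s<K} Σ_{m∈(M,2M]} [m = m₀ + sj] w(m)`. -/
def B (c : ℤ) (M q V K j : ℕ) (m₀ : ℤ) : ℝ :=
  ∑ s ∈ range K, ∑ m ∈ Ioc M (2 * M), if (m : ℤ) = m₀ + (s : ℤ) * (j : ℤ) then w c q V m else 0

theorem mem_T {M K j m s : ℕ} (hm : m ∈ Ioc M (2 * M)) (hs : s ∈ range K) :
    (m : ℤ) - (s : ℤ) * (j : ℤ) ∈ T M K j := by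
  rw [mem_Ioc] at hm
  rw [mem_range] at hs
  rw [T, mem_Icc]
  have hs' : (s : ℤ) ≤ (K : ℤ) - 1 := by
    have : s + 1 ≤ K := hs
    have : ((s + 1 : ℕ) : ℤ) ≤ K := by exact_mod_cast this
    push_cast at this
    linarith
  have hj : (0 : ℤ) ≤ j := by positivity
  have hm1 : (M : ℤ) + 1 ≤ m := by exact_mod_cast hm.1
  have hm2 : (m : ℤ) ≤ 2 * M := by exact_mod_cast hm.2
  have hs0 : (0 : ℤ) ≤ s := by positivity
  constructor
  · nlinarith
  · nlinarith

theorem card_T (M K j : ℕ) (hK : 1 ≤ K) :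
    ((T M K j).card : ℝ) = M + ((K : ℝ) - 1) * j := by
  have hK' : (0 : ℤ) ≤ (K : ℤ) - 1 := by
    have : ((1 : ℕ) : ℤ) ≤ K := by exact_mod_cast hK
    push_cast at this
    linarith
  have hj : (0 : ℤ) ≤ j := by positivity
  have hnn : (0 : ℤ) ≤ (M : ℤ) + ((K : ℤ) - 1) * j := by positivity
  have hz : ((T M K j).card : ℤ) = (M : ℤ) + ((K : ℤ) - 1) * j := by
    rw [T, Int.card_Icc]
    rw [Int.toNat_of_nonneg (by linarith)]
    ring
  have : (((T M K j).card : ℤ) : ℝ) = ((M : ℤ) + ((K : ℤ) - 1) * j : ℤ) := by exact_mod_cast hz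
  push_cast at this
  exact this

/-- Elementary re-indexing of an indicator (all atoms integers). -/
theorem ite_shift (a : ℝ) (m m₀ d : ℤ) :
    (if m = m₀ + d then a else 0) = if m₀ = m - d then a else 0 := by
  by_cases h : m = m₀ + d
  · have h0 : m₀ = m - d := by omega
    rw [if_pos h, if_pos h0]
  · have h0 : ¬ (m₀ = m - d) := fun h0 => h (by omega)
    rw [if_neg h, if_neg h0]

/-- `Σ_{m₀∈T} B_j(m₀) = K · Σ_m w(m)`: every `m ∈ (M,2M]` lies in exactly `K` blocks. -/
theorem sum_B (c : ℤ) (M q V K j : ℕ) :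
    ∑ m₀ ∈ T M K j, B c M q V K j m₀ = (K : ℝ) * ∑ m ∈ Ioc M (2 * M), w c q V m := by
  unfold B
  rw [sum_comm]
  have hinner : ∀ s ∈ range K,
      ∑ m₀ ∈ T M K j, ∑ m ∈ Ioc M (2 * M),
        (if (m : ℤ) = m₀ + (s : ℤ) * (j : ℤ) then w c q V m else 0) =
      ∑ m ∈ Ioc M (2 * M), w c q V m := by
    intro s hs
    rw [sum_comm]
    refine sum_congr rfl fun m hm => ?_
    have h1 : ∀ m₀ : ℤ, (if (m : ℤ) = m₀ + (s : ℤ) * (j : ℤ) then w c q V m else 0) =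
        if m₀ = (m : ℤ) - (s : ℤ) * (j : ℤ) then w c q V m else 0 :=
      fun m₀ => ite_shift _ _ _ _
    simp_rw [h1]
    rw [sum_ite_eq' (T M K j) ((m : ℤ) - (s : ℤ) * (j : ℤ)) (fun _ => w c q V m), if_pos (mem_T hm hs)]
  rw [sum_congr rfl hinner, sum_const, card_range, nsmul_eq_mul]

/-- Pulling a finite double sum out of an indicator. -/
theorem ite_sum_sum {α β : Type*} (p : Prop) [Decidable p] (A : Finset α) (Bs : Finset β)
    (f : α → β → ℝ) :
    (if p then ∑ x ∈ A, ∑ y ∈ Bs, f x y else 0) = ∑ x ∈ A, ∑ y ∈ Bs, if p then f x y else 0 := by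
  split_ifs <;> simp

/-- Four-fold sum swap: `(m, m')` outside ↔ `(ν, ν')` outside. -/
theorem sum_comm4 {α β : Type*} (A : Finset α) (Bs : Finset β) (F : α → α → β → β → ℝ) :
    ∑ m ∈ A, ∑ m' ∈ A, ∑ ν ∈ Bs, ∑ ν' ∈ Bs, F m m' ν ν' =
      ∑ ν ∈ Bs, ∑ ν' ∈ Bs, ∑ m ∈ A, ∑ m' ∈ A, F m m' ν ν' := by
  calc ∑ m ∈ A, ∑ m' ∈ A, ∑ ν ∈ Bs, ∑ ν' ∈ Bs, F m m' ν ν'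
      = ∑ m ∈ A, ∑ ν ∈ Bs, ∑ m' ∈ A, ∑ ν' ∈ Bs, F m m' ν ν' := by
        refine sum_congr rfl fun m _ => ?_
        exact sum_comm
    _ = ∑ ν ∈ Bs, ∑ m ∈ A, ∑ m' ∈ A, ∑ ν' ∈ Bs, F m m' ν ν' := sum_comm
    _ = ∑ ν ∈ Bs, ∑ m ∈ A, ∑ ν' ∈ Bs, ∑ m' ∈ A, F m m' ν ν' := by
        refine sum_congr rfl fun ν _ => sum_congr rfl fun m _ => ?_
        exact sum_comm
    _ = ∑ ν ∈ Bs, ∑ ν' ∈ Bs, ∑ m ∈ A, ∑ m' ∈ A, F m m' ν ν' := by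
        refine sum_congr rfl fun ν _ => ?_
        exact sum_comm

/-- The product of two block indicators, summed over the block start, is a lag indicator. -/
theorem sum_T_ite_mul_ite (c : ℤ) (M q V K j : ℕ) {s s' m m' : ℕ}
    (hs : s ∈ range K) (hm : m ∈ Ioc M (2 * M)) :
    ∑ m₀ ∈ T M K j,
      (if (m : ℤ) = m₀ + (s : ℤ) * (j : ℤ) then w c q V m else 0) *
        (if (m' : ℤ) = m₀ + (s' : ℤ) * (j : ℤ) then w c q V m' else 0) =
      if (m : ℤ) - m' = ((s : ℤ) - s') * (j : ℤ) then w c q V m * w c q V m' else 0 := by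
  have h1 : ∀ m₀ : ℤ,
      (if (m : ℤ) = m₀ + (s : ℤ) * (j : ℤ) then w c q V m else 0) *
        (if (m' : ℤ) = m₀ + (s' : ℤ) * (j : ℤ) then w c q V m' else 0) =
      if m₀ = (m : ℤ) - (s : ℤ) * (j : ℤ) then
        (if (m' : ℤ) = m₀ + (s' : ℤ) * (j : ℤ) then w c q V m * w c q V m' else 0) else 0 := by
    intro m₀
    by_cases h : (m : ℤ) = m₀ + (s : ℤ) * (j : ℤ)
    · have h0 : m₀ = (m : ℤ) - (s : ℤ) * (j : ℤ) := by linarith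
      rw [if_pos h, if_pos h0]
      by_cases h' : (m' : ℤ) = m₀ + (s' : ℤ) * (j : ℤ)
      · rw [if_pos h', if_pos h']
      · rw [if_neg h', if_neg h', mul_zero]
    · have h0 : ¬ (m₀ = (m : ℤ) - (s : ℤ) * (j : ℤ)) := fun h0 => h (by linarith)
      rw [if_neg h, if_neg h0, zero_mul]
  simp_rw [h1]
  rw [sum_ite_eq' (T M K j) ((m : ℤ) - (s : ℤ) * (j : ℤ)), if_pos (mem_T hm hs)]
  have hiff : ((m' : ℤ) = (m : ℤ) - (s : ℤ) * (j : ℤ) + (s' : ℤ) * (j : ℤ)) ↔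
      ((m : ℤ) - m' = ((s : ℤ) - s') * (j : ℤ)) := by
    rw [sub_mul]
    constructor
    · intro h; linarith
    · intro h; linarith
  by_cases h : (m' : ℤ) = (m : ℤ) - (s : ℤ) * (j : ℤ) + (s' : ℤ) * (j : ℤ)
  · rw [if_pos h, if_pos (hiff.mp h)]
  · rw [if_neg h, if_neg (fun h' => h (hiff.mpr h'))]

/-- EXPANSION at one modulus: `Σ_{m₀∈T_j} B_j(m₀)² = Σ_{s,s'<K} Σ_{ν,ν'} X c (qν) (qν') M ((s−s')j)`. -/
theorem sum_B_sq (c : ℤ) (M q V K j : ℕ) :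
    ∑ m₀ ∈ T M K j, (B c M q V K j m₀) ^ 2 =
      ∑ s ∈ range K, ∑ s' ∈ range K, ∑ ν ∈ Icc 1 V, ∑ ν' ∈ Icc 1 V,
        X c (q * ν) (q * ν') M (((s : ℤ) - s') * (j : ℤ)) := by
  -- Step 1: expand the square and move the block start inside.
  have step1 : ∑ m₀ ∈ T M K j, (B c M q V K j m₀) ^ 2 =
      ∑ s ∈ range K, ∑ s' ∈ range K, ∑ m₀ ∈ T M K j,
        (∑ m ∈ Ioc M (2 * M), if (m : ℤ) = m₀ + (s : ℤ) * (j : ℤ) then w c q V m else 0) *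
          (∑ m' ∈ Ioc M (2 * M), if (m' : ℤ) = m₀ + (s' : ℤ) * (j : ℤ) then w c q V m' else 0) := by
    calc ∑ m₀ ∈ T M K j, (B c M q V K j m₀) ^ 2
        = ∑ m₀ ∈ T M K j, ∑ s ∈ range K, ∑ s' ∈ range K,
            (∑ m ∈ Ioc M (2 * M), if (m : ℤ) = m₀ + (s : ℤ) * (j : ℤ) then w c q V m else 0) *
              (∑ m' ∈ Ioc M (2 * M),
                if (m' : ℤ) = m₀ + (s' : ℤ) * (j : ℤ) then w c q V m' else 0) := by
          refine sum_congr rfl fun m₀ _ => ?_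
          rw [B, sq, sum_mul_sum]
      _ = ∑ s ∈ range K, ∑ m₀ ∈ T M K j, ∑ s' ∈ range K,
            (∑ m ∈ Ioc M (2 * M), if (m : ℤ) = m₀ + (s : ℤ) * (j : ℤ) then w c q V m else 0) *
              (∑ m' ∈ Ioc M (2 * M),
                if (m' : ℤ) = m₀ + (s' : ℤ) * (j : ℤ) then w c q V m' else 0) := sum_comm
      _ = _ := by
          refine sum_congr rfl fun s _ => ?_
          exact sum_comm
  rw [step1]
  refine sum_congr rfl fun s hs => sum_congr rfl fun s' hs' => ?_
  -- Step 2: for fixed (s, s'), evaluate the block-start sum.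
  calc ∑ m₀ ∈ T M K j,
        (∑ m ∈ Ioc M (2 * M), if (m : ℤ) = m₀ + (s : ℤ) * (j : ℤ) then w c q V m else 0) *
          (∑ m' ∈ Ioc M (2 * M), if (m' : ℤ) = m₀ + (s' : ℤ) * (j : ℤ) then w c q V m' else 0)
      = ∑ m₀ ∈ T M K j, ∑ m ∈ Ioc M (2 * M), ∑ m' ∈ Ioc M (2 * M),
          (if (m : ℤ) = m₀ + (s : ℤ) * (j : ℤ) then w c q V m else 0) *
            (if (m' : ℤ) = m₀ + (s' : ℤ) * (j : ℤ) then w c q V m' else 0) := by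
        refine sum_congr rfl fun m₀ _ => ?_
        rw [sum_mul_sum]
    _ = ∑ m ∈ Ioc M (2 * M), ∑ m₀ ∈ T M K j, ∑ m' ∈ Ioc M (2 * M),
          (if (m : ℤ) = m₀ + (s : ℤ) * (j : ℤ) then w c q V m else 0) *
            (if (m' : ℤ) = m₀ + (s' : ℤ) * (j : ℤ) then w c q V m' else 0) := sum_comm
    _ = ∑ m ∈ Ioc M (2 * M), ∑ m' ∈ Ioc M (2 * M), ∑ m₀ ∈ T M K j,
          (if (m : ℤ) = m₀ + (s : ℤ) * (j : ℤ) then w c q V m else 0) *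
            (if (m' : ℤ) = m₀ + (s' : ℤ) * (j : ℤ) then w c q V m' else 0) := by
        refine sum_congr rfl fun m _ => ?_
        exact sum_comm
    _ = ∑ m ∈ Ioc M (2 * M), ∑ m' ∈ Ioc M (2 * M),
          (if (m : ℤ) - m' = ((s : ℤ) - s') * (j : ℤ) then w c q V m * w c q V m' else 0) := by
        refine sum_congr rfl fun m hm => sum_congr rfl fun m' _ => ?_
        exact sum_T_ite_mul_ite c M q V K j hs hm
    _ = ∑ m ∈ Ioc M (2 * M), ∑ m' ∈ Ioc M (2 * M), ∑ ν ∈ Icc 1 V, ∑ ν' ∈ Icc 1 V,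
          (if (m : ℤ) - m' = ((s : ℤ) - s') * (j : ℤ) then
            L ((m : ℤ) * ((q * ν : ℕ) : ℤ) + c) * L ((m' : ℤ) * ((q * ν' : ℕ) : ℤ) + c) else 0) := by
        refine sum_congr rfl fun m _ => sum_congr rfl fun m' _ => ?_
        rw [← ite_sum_sum]
        congr 1
        rw [w, w, sum_mul_sum]
    _ = ∑ ν ∈ Icc 1 V, ∑ ν' ∈ Icc 1 V, ∑ m ∈ Ioc M (2 * M), ∑ m' ∈ Ioc M (2 * M),
          (if (m : ℤ) - m' = ((s : ℤ) - s') * (j : ℤ) then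
            L ((m : ℤ) * ((q * ν : ℕ) : ℤ) + c) * L ((m' : ℤ) * ((q * ν' : ℕ) : ℤ) + c) else 0) :=
        sum_comm4 _ _ _
    _ = ∑ ν ∈ Icc 1 V, ∑ ν' ∈ Icc 1 V, X c (q * ν) (q * ν') M (((s : ℤ) - s') * (j : ℤ)) := by
        refine sum_congr rfl fun ν _ => sum_congr rfl fun ν' _ => ?_
        rw [X_eq_ite]

/-- EXPANSION summed over the moduli: `Σ_j Σ_{T_j} B_j² = Σ_{s,s'} Σ_{ν,ν'} fan c (qν) (qν') M (s − s')`. -/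
theorem sum_j_sum_B_sq (c : ℤ) (M q V K : ℕ) :
    ∑ j ∈ Ico (Nat.sqrt M + 1) (2 * (Nat.sqrt M + 1)), ∑ m₀ ∈ T M K j, (B c M q V K j m₀) ^ 2 =
      ∑ s ∈ range K, ∑ s' ∈ range K, ∑ ν ∈ Icc 1 V, ∑ ν' ∈ Icc 1 V,
        fan c (q * ν) (q * ν') M ((s : ℤ) - s') := by
  calc ∑ j ∈ Ico (Nat.sqrt M + 1) (2 * (Nat.sqrt M + 1)), ∑ m₀ ∈ T M K j, (B c M q V K j m₀) ^ 2
      = ∑ j ∈ Ico (Nat.sqrt M + 1) (2 * (Nat.sqrt M + 1)),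
          ∑ s ∈ range K, ∑ s' ∈ range K, ∑ ν ∈ Icc 1 V, ∑ ν' ∈ Icc 1 V,
            X c (q * ν) (q * ν') M (((s : ℤ) - s') * (j : ℤ)) :=
        sum_congr rfl fun j _ => sum_B_sq c M q V K j
    _ = ∑ s ∈ range K, ∑ j ∈ Ico (Nat.sqrt M + 1) (2 * (Nat.sqrt M + 1)),
          ∑ s' ∈ range K, ∑ ν ∈ Icc 1 V, ∑ ν' ∈ Icc 1 V,
            X c (q * ν) (q * ν') M (((s : ℤ) - s') * (j : ℤ)) := sum_comm
    _ = ∑ s ∈ range K, ∑ s' ∈ range K, ∑ j ∈ Ico (Nat.sqrt M + 1) (2 * (Nat.sqrt M + 1)),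
          ∑ ν ∈ Icc 1 V, ∑ ν' ∈ Icc 1 V,
            X c (q * ν) (q * ν') M (((s : ℤ) - s') * (j : ℤ)) := by
        refine sum_congr rfl fun s _ => ?_
        exact sum_comm
    _ = ∑ s ∈ range K, ∑ s' ∈ range K, ∑ ν ∈ Icc 1 V,
          ∑ j ∈ Ico (Nat.sqrt M + 1) (2 * (Nat.sqrt M + 1)), ∑ ν' ∈ Icc 1 V,
            X c (q * ν) (q * ν') M (((s : ℤ) - s') * (j : ℤ)) := by
        refine sum_congr rfl fun s _ => sum_congr rfl fun s' _ => ?_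
        exact sum_comm
    _ = ∑ s ∈ range K, ∑ s' ∈ range K, ∑ ν ∈ Icc 1 V, ∑ ν' ∈ Icc 1 V,
          ∑ j ∈ Ico (Nat.sqrt M + 1) (2 * (Nat.sqrt M + 1)),
            X c (q * ν) (q * ν') M (((s : ℤ) - s') * (j : ℤ)) := by
        refine sum_congr rfl fun s _ => sum_congr rfl fun s' _ => sum_congr rfl fun ν _ => ?_
        exact sum_comm
    _ = _ := by
        refine sum_congr rfl fun s _ => sum_congr rfl fun s' _ =>
          sum_congr rfl fun ν _ => sum_congr rfl fun ν' _ => ?_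
        rw [fan_eq_sum_X]

/-! ## §3 The fan side: bounding the expanded block variance by the crux -/

/-- Under the crux bound for the family `qν`, `ν ≤ V` (off-diagonal, nonzero lag), the expanded block
variance is at most `K·V²·(QM) + K²·V·(QM) + K²·V²·C·M^{3/4+ϑ}`. -/
theorem fan_side_le {c : ℤ} {M q V K : ℕ} {C e : ℝ} (hC : 0 ≤ C)
    (hfan : ∀ ν ∈ Icc 1 V, ∀ ν' ∈ Icc 1 V, ν ≠ ν' → ∀ k : ℤ, k ≠ 0 →
      |fan c (q * ν) (q * ν') M k| ≤ C * (M : ℝ) ^ e) :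
    ∑ s ∈ range K, ∑ s' ∈ range K, ∑ ν ∈ Icc 1 V, ∑ ν' ∈ Icc 1 V,
        fan c (q * ν) (q * ν') M ((s : ℤ) - s') ≤
      (K : ℝ) * V ^ 2 * (((Nat.sqrt M : ℝ) + 1) * M) + (K : ℝ) ^ 2 * V * (((Nat.sqrt M : ℝ) + 1) * M)
        + (K : ℝ) ^ 2 * V ^ 2 * (C * (M : ℝ) ^ e) := by
  set QM : ℝ := ((Nat.sqrt M : ℝ) + 1) * M with hQM
  set CM : ℝ := C * (M : ℝ) ^ e with hCM
  have hQM0 : 0 ≤ QM := by positivity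
  have hCM0 : 0 ≤ CM := by positivity
  -- pointwise bound
  have hpt : ∀ s ∈ range K, ∀ s' ∈ range K, ∀ ν ∈ Icc 1 V, ∀ ν' ∈ Icc 1 V,
      fan c (q * ν) (q * ν') M ((s : ℤ) - s') ≤
        (if s = s' then QM else 0) + (if ν = ν' then QM else 0) + CM := by
    intro s hs s' hs' ν hν ν' hν'
    have htriv : fan c (q * ν) (q * ν') M ((s : ℤ) - s') ≤ QM :=
      le_trans (le_abs_self _) (abs_fan_le _ _ _ _ _)
    by_cases hss : s = s'
    · rw [if_pos hss]
      have : 0 ≤ (if ν = ν' then QM else 0) := by split_ifs <;> linarith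
      linarith
    · rw [if_neg hss, zero_add]
      by_cases hνν : ν = ν'
      · rw [if_pos hνν]; linarith
      · rw [if_neg hνν, zero_add]
        have hk : ((s : ℤ) - s') ≠ 0 := by
          intro h
          apply hss
          exact_mod_cast (sub_eq_zero.mp h)
        exact le_trans (le_abs_self _) (hfan ν hν ν' hν' hνν _ hk)
  -- sum it
  have hsum1 : ∀ s ∈ range K, ∑ s' ∈ range K, (if s = s' then QM else 0) = QM := by
    intro s hs
    rw [sum_ite_eq (range K) s (fun _ => QM), if_pos hs]
  have hsum2 : ∀ ν ∈ Icc 1 V, ∑ ν' ∈ Icc 1 V, (if ν = ν' then QM else 0) = QM := by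
    intro ν hν
    rw [sum_ite_eq (Icc 1 V) ν (fun _ => QM), if_pos hν]
  calc ∑ s ∈ range K, ∑ s' ∈ range K, ∑ ν ∈ Icc 1 V, ∑ ν' ∈ Icc 1 V,
        fan c (q * ν) (q * ν') M ((s : ℤ) - s')
      ≤ ∑ s ∈ range K, ∑ s' ∈ range K, ∑ ν ∈ Icc 1 V, ∑ ν' ∈ Icc 1 V,
          ((if s = s' then QM else 0) + (if ν = ν' then QM else 0) + CM) :=
        sum_le_sum fun s hs => sum_le_sum fun s' hs' => sum_le_sum fun ν hν =>
          sum_le_sum fun ν' hν' => hpt s hs s' hs' ν hν ν' hν'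
    _ = ∑ s ∈ range K, ∑ s' ∈ range K,
          ((V : ℝ) ^ 2 * (if s = s' then QM else 0) + V * QM + V ^ 2 * CM) := by
        refine sum_congr rfl fun s _ => sum_congr rfl fun s' _ => ?_
        have : ∀ ν ∈ Icc 1 V, ∑ ν' ∈ Icc 1 V,
            ((if s = s' then QM else 0) + (if ν = ν' then QM else 0) + CM) =
            (V : ℝ) * (if s = s' then QM else 0) + QM + V * CM := by
          intro ν hν
          rw [sum_add_distrib, sum_add_distrib, hsum2 ν hν, sum_const, sum_const, Nat.card_Icc,
            Nat.add_sub_cancel, nsmul_eq_mul, nsmul_eq_mul]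
        rw [sum_congr rfl this, sum_add_distrib, sum_add_distrib, sum_const, sum_const, sum_const,
          Nat.card_Icc, Nat.add_sub_cancel, nsmul_eq_mul, nsmul_eq_mul, nsmul_eq_mul]
        ring
    _ = ∑ s ∈ range K, ((V : ℝ) ^ 2 * QM + K * (V * QM) + K * (V ^ 2 * CM)) := by
        refine sum_congr rfl fun s hs => ?_
        have hA : ∑ s' ∈ range K, (V : ℝ) ^ 2 * (if s = s' then QM else 0) = (V : ℝ) ^ 2 * QM := by
          rw [← mul_sum, hsum1 s hs]
        rw [sum_add_distrib, sum_add_distrib, hA, sum_const, sum_const,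
          card_range, nsmul_eq_mul, nsmul_eq_mul]
    _ = (K : ℝ) * V ^ 2 * QM + (K : ℝ) ^ 2 * V * QM + (K : ℝ) ^ 2 * V ^ 2 * CM := by
        rw [sum_add_distrib, sum_add_distrib, sum_const, sum_const, sum_const, card_range,
          nsmul_eq_mul, nsmul_eq_mul, nsmul_eq_mul]
        ring

/-! ## §4 The block side: Cauchy–Schwarz lower bound -/

/-- `(K·Σ_m w)² ≤ #T_j · Σ_{T_j} B_j²`. -/
theorem block_side_ge (c : ℤ) (M q V K j : ℕ) :
    ((K : ℝ) * ∑ m ∈ Ioc M (2 * M), w c q V m) ^ 2 ≤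
      ((T M K j).card : ℝ) * ∑ m₀ ∈ T M K j, (B c M q V K j m₀) ^ 2 := by
  rw [← sum_B]
  have h := sum_mul_sq_le_sq_mul_sq (T M K j) (fun _ => (1 : ℝ)) (fun m₀ => B c M q V K j m₀)
  simp only [one_mul, one_pow, sum_const, nsmul_eq_mul, mul_one] at h
  exact h

/-! ## §5 The mirror -/

set_option maxHeartbeats 1600000 in
/-- **Short-block positivity over a dilation family.**  For `c ≠ 0`, a coherent class bias at shift
`c` is incompatible with the fan crux `FanDecorrelation` ALONE. -/
theorem not_coherentBias_of_fanDecorrelation {c : ℤ} (hc : c ≠ 0) (hF : FanDecorrelation) :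
    ¬ CoherentBias c := by
  intro hB
  obtain ⟨ϑ, hϑ, C, hCfan⟩ := fanDecorrelation_iff.mp hF c hc
  -- constants
  obtain ⟨Cp, hCp⟩ : ∃ Cp : ℝ, Cp = max C 0 := ⟨_, rfl⟩
  have hCp0 : 0 ≤ Cp := by rw [hCp]; exact le_max_right _ _
  have hCle : C ≤ Cp := by rw [hCp]; exact le_max_left _ _
  obtain ⟨κ, hκ⟩ : ∃ κ : ℝ, κ = min (1 / 8) ((1 / 4 - ϑ) / 2) := ⟨_, rfl⟩
  have hκpos : 0 < κ := by
    rw [hκ]; apply lt_min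
    · norm_num
    · linarith
  have hκ8 : κ ≤ 1 / 8 := by rw [hκ]; exact min_le_left _ _
  have hκϑ : κ ≤ (1 / 4 - ϑ) / 2 := by rw [hκ]; exact min_le_right _ _
  obtain ⟨M, q, V, b, σ, hσ, hq, hV, hqV, hb, hbV, hVC, hP⟩ := hB κ hκpos (4 * Cp + 4)
  -- basic positivity
  have hM1 : 1 ≤ M := by
    have := Nat.mul_le_mul hq hV
    omega
  have hMr1 : (1 : ℝ) ≤ M := by exact_mod_cast hM1
  have hMpos : (0 : ℝ) < M := by linarith
  have hVr1 : (1 : ℝ) ≤ V := by exact_mod_cast hV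
  have hVpos : (0 : ℝ) < V := by linarith
  -- the modulus count `Qr = ⌊√M⌋ + 1`
  obtain ⟨Qr, hQr⟩ : ∃ Qr : ℝ, Qr = (Nat.sqrt M : ℝ) + 1 := ⟨_, rfl⟩
  have hQ1 : (1 : ℝ) ≤ Qr := by
    rw [hQr]; linarith [(Nat.cast_nonneg (Nat.sqrt M) : (0:ℝ) ≤ _)]
  have hQpos : (0 : ℝ) < Qr := by linarith
  have hsqrtM1 : (1 : ℝ) ≤ Real.sqrt M := by
    rw [show (1 : ℝ) = Real.sqrt 1 by simp]
    exact Real.sqrt_le_sqrt hMr1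
  have hQle : Qr ≤ 2 * Real.sqrt M := by
    have h1 : (Nat.sqrt M : ℝ) ≤ Real.sqrt M := by
      have hsq : ((Nat.sqrt M : ℝ)) ^ 2 ≤ M := by
        have := Nat.sqrt_le' M
        exact_mod_cast this
      calc (Nat.sqrt M : ℝ) = Real.sqrt (((Nat.sqrt M : ℝ)) ^ 2) := by
            rw [Real.sqrt_sq (Nat.cast_nonneg _)]
        _ ≤ Real.sqrt M := Real.sqrt_le_sqrt hsq
    rw [hQr]; linarith
  have hJcard : ((Ico (Nat.sqrt M + 1) (2 * (Nat.sqrt M + 1))).card : ℝ) = Qr := by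
    have hc' : (Ico (Nat.sqrt M + 1) (2 * (Nat.sqrt M + 1))).card = Nat.sqrt M + 1 := by
      rw [Nat.card_Ico]; omega
    rw [hc', hQr]; push_cast; ring
  -- `4V ≤ M^κ` and `4 V Cp ≤ M^κ`
  have hVCp0 : 0 ≤ (V : ℝ) * Cp := mul_nonneg hVpos.le hCp0
  have hV4 : 4 * (V : ℝ) ≤ (M : ℝ) ^ κ := by linarith only [hVC, hVCp0]
  have hVC4 : 4 * (V : ℝ) * Cp ≤ (M : ℝ) ^ κ := by linarith only [hVC, hVCp0, hVpos]
  -- rpow bookkeeping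
  have hMκ_le_18 : (M : ℝ) ^ κ ≤ (M : ℝ) ^ (1 / 8 : ℝ) :=
    Real.rpow_le_rpow_of_exponent_le hMr1 hκ8
  have hMκ_ge4 : (4 : ℝ) ≤ (M : ℝ) ^ κ := by linarith only [hV4, hVr1]
  have hM38_ge4 : (4 : ℝ) ≤ (M : ℝ) ^ (3 / 8 : ℝ) :=
    le_trans hMκ_ge4 (Real.rpow_le_rpow_of_exponent_le hMr1 (by linarith))
  -- the block length `K = 4V`
  obtain ⟨K, hKdef⟩ : ∃ K : ℕ, K = 4 * V := ⟨_, rfl⟩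
  have hKr : (K : ℝ) = 4 * V := by rw [hKdef]; push_cast; ring
  have hK1 : 1 ≤ K := by rw [hKdef]; omega
  have hKpos : (0 : ℝ) < K := by rw [hKr]; linarith
  -- `2 Qr K ≤ M`
  have h2QK : 2 * Qr * K ≤ M := by
    have h58 : Real.sqrt M * (M : ℝ) ^ (1 / 8 : ℝ) = (M : ℝ) ^ (5 / 8 : ℝ) := by
      rw [Real.sqrt_eq_rpow, ← Real.rpow_add hMpos]; norm_num
    have h1 : (M : ℝ) ^ (5 / 8 : ℝ) * (M : ℝ) ^ (3 / 8 : ℝ) = M := by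
      rw [← Real.rpow_add hMpos]; norm_num
    have h58pos : 0 ≤ (M : ℝ) ^ (5 / 8 : ℝ) := Real.rpow_nonneg hMpos.le _
    have h18 : 4 * (V : ℝ) ≤ (M : ℝ) ^ (1 / 8 : ℝ) := le_trans hV4 hMκ_le_18
    have hs0 : 0 ≤ Real.sqrt M := Real.sqrt_nonneg _
    have hA : 2 * Qr * (4 * (V : ℝ)) ≤ 2 * (2 * Real.sqrt M) * (4 * V) := by
      have := mul_le_mul_of_nonneg_right hQle (show (0:ℝ) ≤ 4 * V by linarith only [hVpos])
      linarith only [this]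
    have hB' : 2 * (2 * Real.sqrt M) * (4 * (V : ℝ)) ≤ 2 * (2 * Real.sqrt M) * (M : ℝ) ^ (1 / 8 : ℝ) := by
      have := mul_le_mul_of_nonneg_left h18 (show (0:ℝ) ≤ 2 * (2 * Real.sqrt M) by linarith only [hs0])
      linarith only [this]
    have hC' : 4 * (M : ℝ) ^ (5 / 8 : ℝ) ≤ (M : ℝ) ^ (3 / 8 : ℝ) * (M : ℝ) ^ (5 / 8 : ℝ) := by
      have := mul_le_mul_of_nonneg_right hM38_ge4 h58pos
      linarith only [this]
    calc 2 * Qr * K = 2 * Qr * (4 * V) := by rw [hKr]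
      _ ≤ 2 * (2 * Real.sqrt M) * (4 * V) := hA
      _ ≤ 2 * (2 * Real.sqrt M) * (M : ℝ) ^ (1 / 8 : ℝ) := hB'
      _ = 4 * (M : ℝ) ^ (5 / 8 : ℝ) := by rw [← h58]; ring
      _ ≤ (M : ℝ) ^ (3 / 8 : ℝ) * (M : ℝ) ^ (5 / 8 : ℝ) := hC'
      _ = M := by rw [mul_comm, h1]
  -- the fan hypothesis on the family
  have hfan : ∀ ν ∈ Icc 1 V, ∀ ν' ∈ Icc 1 V, ν ≠ ν' → ∀ k : ℤ, k ≠ 0 →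
      |fan c (q * ν) (q * ν') M k| ≤ Cp * (M : ℝ) ^ (3 / 4 + ϑ) := by
    intro ν hν ν' hν' hνν k hk
    rw [mem_Icc] at hν hν'
    have h := hCfan M (q * ν) (q * ν') k
      ((one_mul 1).symm.trans_le (Nat.mul_le_mul hq hν.1))
      ((one_mul 1).symm.trans_le (Nat.mul_le_mul hq hν'.1))
      (fun heq => hνν (Nat.eq_of_mul_eq_mul_left (by omega) heq))
      (le_trans (Nat.mul_le_mul_left q hν.2) hqV)
      (le_trans (Nat.mul_le_mul_left q hν'.2) hqV) hk
    exact le_trans h (mul_le_mul_of_nonneg_right hCle (Real.rpow_nonneg hMpos.le _))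
  -- the family sum
  obtain ⟨Wsum, hWsum⟩ : ∃ Wsum : ℝ, Wsum = ∑ m ∈ Ioc M (2 * M), w c q V m := ⟨_, rfl⟩
  -- (1) lower bound on the family sum: `Wsum² ≥ (V b M)²`
  have hW : ((V : ℝ) * (b * M)) ^ 2 ≤ Wsum ^ 2 := by
    have hsum : (V : ℝ) * (b * M) ≤ σ * Wsum := by
      rw [hWsum, sum_w_eq, mul_sum]
      calc (V : ℝ) * (b * M) = ∑ _ν ∈ Icc 1 V, b * M := by
            rw [sum_const, Nat.card_Icc, Nat.add_sub_cancel, nsmul_eq_mul]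
        _ ≤ ∑ ν ∈ Icc 1 V, σ * P c (q * ν) M :=
            sum_le_sum fun ν hν => by
              rw [mem_Icc] at hν
              exact hP ν hν.1 hν.2
    have hnn : 0 ≤ (V : ℝ) * (b * M) := by positivity
    have hσ2 : σ ^ 2 = 1 := by rcases hσ with h | h <;> simp [h]
    calc ((V : ℝ) * (b * M)) ^ 2 ≤ (σ * Wsum) ^ 2 := by
          exact pow_le_pow_left₀ hnn hsum 2
      _ = Wsum ^ 2 := by rw [mul_pow, hσ2, one_mul]
  -- (2) per-modulus block inequality and its sum over `j`
  have hblock : ∀ j ∈ Ico (Nat.sqrt M + 1) (2 * (Nat.sqrt M + 1)), ((K : ℝ) * Wsum) ^ 2 ≤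
      2 * (M : ℝ) * ∑ m₀ ∈ T M K j, (B c M q V K j m₀) ^ 2 := by
    intro j hj
    have hjlt : (j : ℝ) ≤ 2 * Qr := by
      rw [mem_Ico] at hj
      have : (j : ℝ) < ((2 * (Nat.sqrt M + 1) : ℕ) : ℝ) := by exact_mod_cast hj.2
      push_cast at this
      rw [hQr]; linarith
    have hT : ((T M K j).card : ℝ) ≤ 2 * M := by
      rw [card_T M K j hK1]
      have hj0 : (0 : ℝ) ≤ j := Nat.cast_nonneg _
      have h1 : ((K : ℝ) - 1) * j ≤ (K : ℝ) * j := by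
        rw [sub_mul, one_mul]; linarith only [hj0]
      have h2 : (K : ℝ) * j ≤ (K : ℝ) * (2 * Qr) := mul_le_mul_of_nonneg_left hjlt hKpos.le
      linarith only [h1, h2, h2QK]
    have hnn : 0 ≤ ∑ m₀ ∈ T M K j, (B c M q V K j m₀) ^ 2 := sum_nonneg fun _ _ => sq_nonneg _
    calc ((K : ℝ) * Wsum) ^ 2 ≤ ((T M K j).card : ℝ) * ∑ m₀ ∈ T M K j, (B c M q V K j m₀) ^ 2 := by
          rw [hWsum]; exact block_side_ge c M q V K j
      _ ≤ 2 * (M : ℝ) * ∑ m₀ ∈ T M K j, (B c M q V K j m₀) ^ 2 :=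
          mul_le_mul_of_nonneg_right hT hnn
  have hmain : Qr * ((K : ℝ) * Wsum) ^ 2 ≤
      2 * (M : ℝ) * ((K : ℝ) * V ^ 2 * (Qr * M) + (K : ℝ) ^ 2 * V * (Qr * M)
        + (K : ℝ) ^ 2 * V ^ 2 * (Cp * (M : ℝ) ^ (3 / 4 + ϑ))) := by
    calc Qr * ((K : ℝ) * Wsum) ^ 2
        = ∑ _j ∈ Ico (Nat.sqrt M + 1) (2 * (Nat.sqrt M + 1)), ((K : ℝ) * Wsum) ^ 2 := by
          rw [sum_const, nsmul_eq_mul, hJcard]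
      _ ≤ ∑ j ∈ Ico (Nat.sqrt M + 1) (2 * (Nat.sqrt M + 1)),
            2 * (M : ℝ) * ∑ m₀ ∈ T M K j, (B c M q V K j m₀) ^ 2 :=
          sum_le_sum hblock
      _ = 2 * (M : ℝ) * ∑ j ∈ Ico (Nat.sqrt M + 1) (2 * (Nat.sqrt M + 1)),
            ∑ m₀ ∈ T M K j, (B c M q V K j m₀) ^ 2 := by
          rw [mul_sum]
      _ = 2 * (M : ℝ) * ∑ s ∈ range K, ∑ s' ∈ range K, ∑ ν ∈ Icc 1 V, ∑ ν' ∈ Icc 1 V,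
            fan c (q * ν) (q * ν') M ((s : ℤ) - s') := by
          rw [sum_j_sum_B_sq]
      _ ≤ 2 * (M : ℝ) * ((K : ℝ) * V ^ 2 * (((Nat.sqrt M : ℝ) + 1) * M)
            + (K : ℝ) ^ 2 * V * (((Nat.sqrt M : ℝ) + 1) * M)
            + (K : ℝ) ^ 2 * V ^ 2 * (Cp * (M : ℝ) ^ (3 / 4 + ϑ))) := by
          refine mul_le_mul_of_nonneg_left (fan_side_le hCp0 hfan) (by positivity)
      _ = _ := by rw [← hQr]
  -- (3) arithmetic: combine (1), (2) with `K = 4V`, `b²V ≥ 4`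
  obtain ⟨E, hE⟩ : ∃ E : ℝ, E = (M : ℝ) ^ (3 / 4 + ϑ) := ⟨_, rfl⟩
  have hE0 : 0 ≤ E := by rw [hE]; exact Real.rpow_nonneg hMpos.le _
  rw [← hE] at hmain
  -- from hmain and hW:  Qr K² (VbM)² ≤ 2M (K V² Qr M + K² V Qr M + K² V² Cp E)
  have h3 : Qr * (K : ℝ) ^ 2 * ((V : ℝ) * (b * M)) ^ 2 ≤
      2 * (M : ℝ) * ((K : ℝ) * V ^ 2 * (Qr * M) + (K : ℝ) ^ 2 * V * (Qr * M)
        + (K : ℝ) ^ 2 * V ^ 2 * (Cp * E)) := by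
    have hKW : (K : ℝ) ^ 2 * ((V : ℝ) * (b * M)) ^ 2 ≤ (K : ℝ) ^ 2 * Wsum ^ 2 :=
      mul_le_mul_of_nonneg_left hW (sq_nonneg _)
    have hQKW : Qr * ((K : ℝ) ^ 2 * ((V : ℝ) * (b * M)) ^ 2) ≤ Qr * ((K : ℝ) ^ 2 * Wsum ^ 2) :=
      mul_le_mul_of_nonneg_left hKW hQpos.le
    calc Qr * (K : ℝ) ^ 2 * ((V : ℝ) * (b * M)) ^ 2
        = Qr * ((K : ℝ) ^ 2 * ((V : ℝ) * (b * M)) ^ 2) := by ring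
      _ ≤ Qr * ((K : ℝ) ^ 2 * Wsum ^ 2) := hQKW
      _ = Qr * ((K : ℝ) * Wsum) ^ 2 := by ring
      _ ≤ _ := hmain
  -- substitute K = 4V and use b² V ≥ 4
  have hb2V : 4 ≤ b ^ 2 * (V : ℝ) := hbV
  have h4 : 64 * Qr * (V : ℝ) ^ 3 * (M : ℝ) ^ 2 ≤
      40 * Qr * (V : ℝ) ^ 3 * (M : ℝ) ^ 2 + 32 * (V : ℝ) ^ 4 * Cp * (M * E) := by
    rw [hKr] at h3
    have hl : 64 * Qr * (V : ℝ) ^ 3 * (M : ℝ) ^ 2 ≤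
        Qr * (4 * (V : ℝ)) ^ 2 * ((V : ℝ) * (b * M)) ^ 2 := by
      have hfac : Qr * (4 * (V : ℝ)) ^ 2 * ((V : ℝ) * (b * M)) ^ 2 =
          16 * Qr * (V : ℝ) ^ 3 * (M : ℝ) ^ 2 * (b ^ 2 * V) := by ring
      rw [hfac]
      have hpos : 0 ≤ 16 * Qr * (V : ℝ) ^ 3 * (M : ℝ) ^ 2 := by positivity
      have := mul_le_mul_of_nonneg_left hb2V hpos
      linarith only [this]
    have hr : 2 * (M : ℝ) * (4 * (V : ℝ) * (V : ℝ) ^ 2 * (Qr * M)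
        + (4 * (V : ℝ)) ^ 2 * V * (Qr * M) + (4 * (V : ℝ)) ^ 2 * (V : ℝ) ^ 2 * (Cp * E)) =
        40 * Qr * (V : ℝ) ^ 3 * (M : ℝ) ^ 2 + 32 * (V : ℝ) ^ 4 * Cp * (M * E) := by ring
    linarith
  -- hence `3 Qr M² ≤ 4 V Cp (M E) ≤ M^κ (M E)`
  have h5 : 3 * Qr * (M : ℝ) ^ 2 ≤ (M : ℝ) ^ κ * (M * E) := by
    have hV3 : (0 : ℝ) < (V : ℝ) ^ 3 := by positivity
    have h6 : 24 * Qr * (M : ℝ) ^ 2 ≤ 32 * (V : ℝ) * Cp * (M * E) := by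
      have hfac : 32 * (V : ℝ) ^ 4 * Cp * (M * E) = (V : ℝ) ^ 3 * (32 * (V : ℝ) * Cp * (M * E)) := by
        ring
      rw [hfac] at h4
      have h7 : (V : ℝ) ^ 3 * (24 * Qr * (M : ℝ) ^ 2) ≤
          (V : ℝ) ^ 3 * (32 * (V : ℝ) * Cp * (M * E)) := by linarith only [h4]
      exact le_of_mul_le_mul_left h7 hV3
    have hME : 0 ≤ (M : ℝ) * E := by positivity
    have h9 := mul_le_mul_of_nonneg_right hVC4 hME
    linarith only [h6, h9]
  -- but `M^κ · M · E = M^{κ + 1 + 3/4 + ϑ} ≤ M² < 3 Qr M²`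
  have h8 : (M : ℝ) ^ κ * (M * E) ≤ (M : ℝ) ^ 2 := by
    have hexp' : (M : ℝ) ^ κ * (M * E) = (M : ℝ) ^ (κ + 1 + (3 / 4 + ϑ)) := by
      rw [hE, Real.rpow_add hMpos (κ + 1) (3 / 4 + ϑ), Real.rpow_add hMpos κ 1, Real.rpow_one]; ring
    rw [hexp']
    have hexp : κ + 1 + (3 / 4 + ϑ) ≤ (2 : ℝ) := by linarith
    calc (M : ℝ) ^ (κ + 1 + (3 / 4 + ϑ)) ≤ (M : ℝ) ^ (2 : ℝ) :=
          Real.rpow_le_rpow_of_exponent_le hMr1 hexp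
      _ = (M : ℝ) ^ 2 := by exact_mod_cast Real.rpow_natCast (M : ℝ) 2
  have hM2 : (0 : ℝ) < (M : ℝ) ^ 2 := by positivity
  have h10 := mul_le_mul_of_nonneg_right hQ1 hM2.le
  linarith only [h5, h8, h10, hM2]


/-- **The fan Siegel mirror.**  `FanDecorrelation` alone implies that Siegel zeros of quality
`≥ C₀ log q` do not occur at arbitrarily large conductors. -/
theorem fanSiegelMirror (hF : FanDecorrelation) :
    ∃ C₀ : ℝ, 0 < C₀ ∧ ¬ SiegelZerosAbove (fun q => C₀ * Real.log q) := by
  obtain ⟨C₀, hC₀, himp⟩ := coherentBias_one_of_siegelZerosAbove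
  exact ⟨C₀, hC₀, fun hz => not_coherentBias_of_fanDecorrelation one_ne_zero hF (himp hz)⟩

/-- `_false_of_` form: Siegel zeros of every logarithmic quality at arbitrarily large conductors
refute `FanDecorrelation` (hardness certificate; the hypothesis is believed false). -/
theorem FanDecorrelation_false_of_siegelZerosAbove
    (hz : ∀ C₀ : ℝ, 0 < C₀ → SiegelZerosAbove (fun q => C₀ * Real.log q)) : ¬ FanDecorrelation :=
  fun hF => by
    obtain ⟨C₀, hC₀, hno⟩ := fanSiegelMirror hF
    exact hno (hz C₀ hC₀)

/-- **The fan mirror as a zero-free interval.**  Under `FanDecorrelation` alone there are `C₀ > 0` and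
`q₀` such that `L(σ, χ) ≠ 0` for every conductor `q ≥ q₀`, every primitive quadratic `χ mod q` and every
real `σ ∈ [1 − 1/(C₀ log² q), 1)`. -/
theorem fanSiegelMirror_realZeroFree (hF : FanDecorrelation) :
    ∃ C₀ : ℝ, 0 < C₀ ∧ ∃ q₀ : ℕ, ∀ (q : ℕ) [NeZero q] (χ : DirichletCharacter ℂ q),
      χ.IsPrimitive → χ.IsQuadratic → q₀ ≤ q →
        ∀ σ : ℝ, 1 - 1 / (C₀ * Real.log q ^ 2) ≤ σ → σ < 1 → χ.LFunction (σ : ℂ) ≠ 0 := by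
  obtain ⟨C₀, hC₀, hno⟩ := fanSiegelMirror hF
  exact ⟨C₀, hC₀, realZeroFree_of_not_siegelZerosAbove hC₀ hno⟩

end Summit.Parity.GeneralizedHardyLittlewood.Cruxes.FanDecorrelation.StrategistMirror

end
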